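import Mathlib.NumberTheory.ModularForms.Petersson
import Mathlib.NumberTheory.ModularForms.Bounds
import Literature.NumberTheory.EllipticCurves.ModularSymbolsProofs
import HarnessLib

/-!
# The `SL₂(ℤ)`-trace of the Petersson density `|f|² yᵏ` of a cusp form on `Γ₀(N)`

Topic `NumberTheory/EllipticCurves` (modular forms on `Γ₀(N)`), namespace
`Literature.NumberTheory.EllipticCurves.ModularForms`. First brick of an unconditional proof of
the classical power-saving bound `aₙ(f) ≪ n^{k/2 - δ}` for cusp forms `f ∈ S_k(Γ₀(N))`
(Rankin 1939, Selberg 1940) by the Rankin–Selberg method run against the LEVEL-ONE real-analytic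
Eisenstein series `E(z, s)` of the tree (`Literature.NumberTheory.Automorphic.eisensteinE`,
`completedEisenstein`; Iwaniec, *Spectral Methods*, Ch. 3): instead of the Eisenstein series of
the cusp `∞` of `Γ₀(N)` one unfolds `E(z, s)` for `SL₂(ℤ)` against the `SL₂(ℤ)`-INVARIANT function

  `G_f(τ) = Σ_{A ∈ SL₂(ℤ)/Γ₀(N)} F_f(A⁻¹ τ)`,   `F_f(τ) = |f(τ)|² (Im τ)ᵏ`

(Rankin 1939, §4: "we sum over a set of representatives of the cosets"; Iwaniec–Kowalski,
*Analytic Number Theory*, §5.1, p. 98, the same device for the `L²`-norm on `Γ₀(q)\ℍ`). This file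
defines `F_f` (`petDensity`, the real number `‖petersson k f f τ‖` of Mathlib) and `G_f`
(`rsTrace`) and PROVES:

* `petDensity_slash`, `petDensity_smul_of_mem` — `F_{f|A}(τ) = F_f(Aτ)` (`A ∈ SL₂(ℤ)`, Mathlib
  `petersson_slash_SL`) and `Γ₀(N)`-invariance of `F_f`;
* `rsTrace_smul` — **`G_f(Aτ) = G_f(τ)` for all `A ∈ SL₂(ℤ)`** (right multiplication permutes
  the cosets); `petDensity_le_rsTrace` — `F_f ≤ G_f` (the identity coset); `rsTrace_nonneg`;
* `exists_rsTrace_le` — `G_f` is bounded (Mathlib `CuspFormClass.petersson_bounded_left`);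
  `continuous_rsTrace`;
* `exists_rsTrace_le_exp` — **exponential decay in the cusp**: `G_f(τ) ≤ C e^{-c Im τ}` for
  `Im τ ≥ 1` (each `f |_k A` is a cusp form at `∞` of period `N` — the tree's `periodic_slash`,
  `isCuspFunction_slash` of `ModularSymbolsProofs` — so Mathlib's
  `IsZeroAtImInfty.exp_decay_atImInfty` with `CuspFormClass.zero_at_infty_slash` applies).

No named facts; two definitions (`petDensity`, `rsTrace`).

## References

* R. A. Rankin, *Contributions to the theory of Ramanujan's function `τ(n)` and similar
  arithmetical functions. II*, Proc. Cambridge Philos. Soc. 35 (1939), 357–372, §4.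
* A. Selberg, *Bemerkungen über eine Dirichletsche Reihe, die mit der Theorie der Modulformen nahe
  verbunden ist*, Arch. Math. Naturvid. 43 (1940), 47–50.
* H. Iwaniec, E. Kowalski, *Analytic Number Theory*, AMS Colloq. Publ. 53 (2004), §5.1.
-/

noncomputable section

open UpperHalfPlane ModularForm CongruenceSubgroup Complex Filter
open scoped MatrixGroups ModularForm Topology

namespace Literature.NumberTheory.EllipticCurves.ModularForms

/-! ### The Petersson density `F_f(τ) = |f(τ)|² (Im τ)ᵏ` -/

section Density

variable (k : ℤ)

/-- The **Petersson density** `F_f(τ) = |f(τ)|² (Im τ)ᵏ` of a function `f` on `ℍ` in weight `k`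
(the integrand of the Petersson norm; as a complex number it is Mathlib's `petersson k f f τ`,
`ofReal_petDensity`). [folklore] -/
def petDensity (f : ℍ → ℂ) (τ : ℍ) : ℝ := ‖f τ‖ ^ 2 * τ.im ^ k

/-- `F_f ≥ 0`. [folklore] -/
theorem petDensity_nonneg (f : ℍ → ℂ) (τ : ℍ) : 0 ≤ petDensity k f τ :=
  mul_nonneg (sq_nonneg _) (zpow_nonneg τ.im_pos.le _)

/-- `F_f(τ) = \overline{f(τ)} f(τ) (Im τ)ᵏ = petersson k f f τ`. [folklore] -/
theorem ofReal_petDensity (f : ℍ → ℂ) (τ : ℍ) : (petDensity k f τ : ℂ) = petersson k f f τ := by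
  unfold petDensity petersson
  push_cast
  rw [Complex.conj_mul' (f τ)]

/-- `F_f(τ) = ‖petersson k f f τ‖`. [folklore] -/
theorem petDensity_eq_norm_petersson (f : ℍ → ℂ) (τ : ℍ) :
    petDensity k f τ = ‖petersson k f f τ‖ := by
  rw [← ofReal_petDensity, Complex.norm_real, Real.norm_of_nonneg (petDensity_nonneg k f τ)]

/-- **`F_{f|A}(τ) = F_f(A τ)`** for `A ∈ SL₂(ℤ)` (Mathlib `petersson_slash_SL`). [folklore] -/
theorem petDensity_slash (f : ℍ → ℂ) (A : SL(2, ℤ)) (τ : ℍ) :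
    petDensity k (f ∣[k] A) τ = petDensity k f (A • τ) := by
  apply Complex.ofReal_injective
  rw [ofReal_petDensity, ofReal_petDensity, petersson_slash_SL]

/-- `F_f(γ τ) = F_f(τ)` for `γ` in the level of a slash-invariant form `f`. [folklore] -/
theorem petDensity_smul_of_mem {Γ : Subgroup SL(2, ℤ)} {F : Type*} [FunLike F ℍ ℂ]
    [SlashInvariantFormClass F Γ k] (f : F) {γ : SL(2, ℤ)} (hγ : γ ∈ Γ) (τ : ℍ) :
    petDensity k f (γ • τ) = petDensity k f τ := by
  apply Complex.ofReal_injective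
  rw [ofReal_petDensity, ofReal_petDensity]
  have h := SlashInvariantFormClass.petersson_smul (k := k) (f := f) (f' := f) (τ := τ)
    (Subgroup.mem_map_of_mem (Matrix.SpecialLinearGroup.mapGL ℝ) hγ)
  exact h

end Density

/-! ### The `SL₂(ℤ)`-trace `G_f = Σ_{A ∈ SL₂(ℤ)/Γ₀(N)} F_f ∘ A⁻¹` -/

section Trace

variable (N : ℕ) (k : ℤ)

/-- The **`SL₂(ℤ)`-trace of the Petersson density** of `f` from `Γ₀(N)` to `SL₂(ℤ)`:
`G_f(τ) = Σ_{A Γ₀(N) ∈ SL₂(ℤ)/Γ₀(N)} F_f(A⁻¹ τ)` (a finite sum over the left cosets, through the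
representatives `Quotient.out`; independent of the representatives and `SL₂(ℤ)`-invariant when
`f` is `Γ₀(N)`-invariant: `petDensity_out_inv_smul`, `rsTrace_smul`) (Rankin 1939, §4).
[cite: Rankin1939, §4] -/
def rsTrace (f : ℍ → ℂ) (τ : ℍ) : ℝ :=
  ∑ᶠ q : SL(2, ℤ) ⧸ Gamma0 N, petDensity k f ((Quotient.out q)⁻¹ • τ)

variable {N k}
variable {F : Type*} [FunLike F ℍ ℂ] [SlashInvariantFormClass F (Gamma0 N) k]

/-- Independence of the representative: `F_f((gΓ₀(N)).out⁻¹ τ) = F_f(g⁻¹ τ)`. [folklore] -/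
theorem petDensity_out_inv_smul (f : F) (g : SL(2, ℤ)) (τ : ℍ) :
    petDensity k f ((Quotient.out (QuotientGroup.mk g : SL(2, ℤ) ⧸ Gamma0 N))⁻¹ • τ) =
      petDensity k f (g⁻¹ • τ) := by
  obtain ⟨h, hh⟩ := QuotientGroup.mk_out_eq_mul (Gamma0 N) g
  rw [hh, mul_inv_rev, mul_smul]
  exact petDensity_smul_of_mem k f (inv_mem h.2) _

/-- `G_f` as a finite sum over any `Fintype` structure on the coset space. [folklore] -/
theorem rsTrace_eq_sum [Fintype (SL(2, ℤ) ⧸ Gamma0 N)] (f : ℍ → ℂ) (τ : ℍ) :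
    rsTrace N k f τ = ∑ q : SL(2, ℤ) ⧸ Gamma0 N, petDensity k f ((Quotient.out q)⁻¹ • τ) := by
  unfold rsTrace
  exact finsum_eq_sum_of_fintype _

/-- `G_f ≥ 0`. [folklore] -/
theorem rsTrace_nonneg (f : ℍ → ℂ) (τ : ℍ) : 0 ≤ rsTrace N k f τ :=
  finsum_nonneg fun _ ↦ petDensity_nonneg k f _

variable [NeZero N]

/-- **`SL₂(ℤ)`-invariance of the trace**: `G_f(A τ) = G_f(τ)` for every `A ∈ SL₂(ℤ)` — left
multiplication by `A⁻¹` permutes `SL₂(ℤ)/Γ₀(N)`. [cite: Rankin1939, §4] -/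
theorem rsTrace_smul (f : F) (A : SL(2, ℤ)) (τ : ℍ) : rsTrace N k f (A • τ) = rsTrace N k f τ := by
  classical
  haveI : Fintype (SL(2, ℤ) ⧸ Gamma0 N) := Fintype.ofFinite _
  rw [rsTrace_eq_sum, rsTrace_eq_sum]
  have h : ∀ q : SL(2, ℤ) ⧸ Gamma0 N, petDensity k f ((Quotient.out q)⁻¹ • A • τ) =
      petDensity k f ((Quotient.out (A⁻¹ • q))⁻¹ • τ) := by
    intro q
    have hq : A⁻¹ • q = QuotientGroup.mk (A⁻¹ * Quotient.out q) := by
      conv_lhs => rw [← QuotientGroup.out_eq' q]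
      rfl
    rw [hq, petDensity_out_inv_smul, mul_inv_rev, inv_inv, mul_smul]
  simp_rw [h]
  exact Fintype.sum_equiv (MulAction.toPerm (A⁻¹ : SL(2, ℤ))) _ _ fun q ↦ rfl

/-- **`F_f ≤ G_f`** (the term of the identity coset). [folklore] -/
theorem petDensity_le_rsTrace (f : F) (τ : ℍ) : petDensity k f τ ≤ rsTrace N k f τ := by
  classical
  haveI : Fintype (SL(2, ℤ) ⧸ Gamma0 N) := Fintype.ofFinite _
  rw [rsTrace_eq_sum]
  have h1 : petDensity k f τ =
      petDensity k f ((Quotient.out (QuotientGroup.mk 1 : SL(2, ℤ) ⧸ Gamma0 N))⁻¹ • τ) := by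
    rw [petDensity_out_inv_smul, inv_one, one_smul]
  rw [h1]
  exact Finset.single_le_sum (f := fun q : SL(2, ℤ) ⧸ Gamma0 N ↦
    petDensity k f ((Quotient.out q)⁻¹ • τ)) (fun q _ ↦ petDensity_nonneg k f _) (Finset.mem_univ _)

omit [NeZero N] in
/-- Continuity of `τ ↦ F_f(B τ)`. [folklore] -/
theorem continuous_petDensity_smul {f : ℍ → ℂ} (hf : Continuous f) (B : SL(2, ℤ)) :
    Continuous fun τ : ℍ ↦ petDensity k f (B • τ) := by
  unfold petDensity
  have h1 : Continuous fun τ : ℍ ↦ B • τ := by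
    have e : ∀ τ : ℍ, B • τ = (Matrix.SpecialLinearGroup.mapGL ℝ B : GL (Fin 2) ℝ) • τ :=
      fun τ ↦ rfl
    simp_rw [e]
    exact continuous_const_smul _
  refine ((continuous_norm.comp (hf.comp h1)).pow 2).mul ?_
  refine Continuous.zpow₀ (UpperHalfPlane.continuous_im.comp h1) k fun τ ↦ Or.inl (im_pos _).ne'

omit [NeZero N] in
/-- `G_f` is continuous for continuous `f`. [folklore] -/
theorem continuous_rsTrace [Finite (SL(2, ℤ) ⧸ Gamma0 N)] {f : ℍ → ℂ} (hf : Continuous f) :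
    Continuous (rsTrace N k f) := by
  classical
  haveI : Fintype (SL(2, ℤ) ⧸ Gamma0 N) := Fintype.ofFinite _
  have h : rsTrace N k f = fun τ ↦ ∑ q : SL(2, ℤ) ⧸ Gamma0 N,
      petDensity k f ((Quotient.out q)⁻¹ • τ) := funext fun τ ↦ rsTrace_eq_sum f τ
  rw [h]
  exact continuous_finsetSum _ fun q _ ↦ continuous_petDensity_smul hf _

end Trace

/-! ### Boundedness and decay in the cusp -/

section CuspForm

variable {N : ℕ} [NeZero N] {k : ℤ}

/-- **`G_f` is bounded** for a cusp form `f ∈ S_k(Γ₀(N))`: each term is a value of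
`‖petersson k f f‖`, bounded on `ℍ` (Mathlib `CuspFormClass.petersson_bounded_left`).
[folklore] -/
theorem exists_rsTrace_le (f : CuspForm (Gamma0 N) k) :
    ∃ B : ℝ, 0 ≤ B ∧ ∀ τ : ℍ, rsTrace N k f τ ≤ B := by
  classical
  haveI : Fintype (SL(2, ℤ) ⧸ Gamma0 N) := Fintype.ofFinite _
  obtain ⟨C, hC⟩ := CuspFormClass.petersson_bounded_left k (Gamma0 N : Subgroup (GL (Fin 2) ℝ)) f f
  have hC0 : 0 ≤ C := (norm_nonneg _).trans (hC UpperHalfPlane.I)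
  refine ⟨Fintype.card (SL(2, ℤ) ⧸ Gamma0 N) * C, by positivity, fun τ ↦ ?_⟩
  rw [rsTrace_eq_sum]
  calc ∑ q : SL(2, ℤ) ⧸ Gamma0 N, petDensity k (⇑f) ((Quotient.out q)⁻¹ • τ)
      ≤ ∑ _q : SL(2, ℤ) ⧸ Gamma0 N, C :=
        Finset.sum_le_sum fun q _ ↦ by rw [petDensity_eq_norm_petersson]; exact hC _
    _ = Fintype.card (SL(2, ℤ) ⧸ Gamma0 N) * C := by
        rw [Finset.sum_const, Finset.card_univ, nsmul_eq_mul]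

/-- `yᵏ e^{-a y} ≤ M_{k,a} ` on `y ≥ 1` (`a > 0`): polynomial versus exponential. [folklore] -/
theorem exists_zpow_mul_exp_neg_le (k : ℤ) {a : ℝ} (ha : 0 < a) :
    ∃ M : ℝ, 0 ≤ M ∧ ∀ y : ℝ, 1 ≤ y → y ^ k * Real.exp (-a * y) ≤ M := by
  refine ⟨(k.toNat.factorial : ℝ) / a ^ k.toNat, by positivity, fun y hy ↦ ?_⟩
  have hy0 : 0 ≤ y := zero_le_one.trans hy
  have h1 : y ^ k ≤ y ^ (k.toNat : ℤ) := zpow_le_zpow_right₀ hy (Int.self_le_toNat k)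
  rw [zpow_natCast] at h1
  have h2 : (a * y) ^ k.toNat / k.toNat.factorial ≤ Real.exp (a * y) :=
    Real.pow_div_factorial_le_exp _ (by positivity) _
  have hfac : (0 : ℝ) < k.toNat.factorial := by positivity
  have hak : (0 : ℝ) < a ^ k.toNat := by positivity
  rw [div_le_iff₀ hfac, mul_pow] at h2
  -- `y^n ≤ n! e^{a y} / a^n`
  have h3 : y ^ k.toNat ≤ k.toNat.factorial / a ^ k.toNat * Real.exp (a * y) := by
    rw [div_mul_eq_mul_div, le_div_iff₀ hak]
    linarith
  calc y ^ k * Real.exp (-a * y) ≤ y ^ k.toNat * Real.exp (-a * y) :=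
        mul_le_mul_of_nonneg_right h1 (Real.exp_pos _).le
    _ ≤ (k.toNat.factorial / a ^ k.toNat * Real.exp (a * y)) * Real.exp (-a * y) :=
        mul_le_mul_of_nonneg_right h3 (Real.exp_pos _).le
    _ = k.toNat.factorial / a ^ k.toNat := by
        rw [mul_assoc, ← Real.exp_add, show a * y + -a * y = 0 by ring, Real.exp_zero, mul_one]

/-- **Exponential decay of each translate**: for `f ∈ S_k(Γ₀(N))` and `A ∈ SL₂(ℤ)` there are
`C, y₀` with `F_{f|A}(τ) = |(f|_k A)(τ)|² (Im τ)ᵏ ≤ C e^{-2π Im τ/N}` for `Im τ ≥ y₀` — `f|_k A`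
vanishes at `∞` (Mathlib `CuspFormClass.zero_at_infty_slash`) and is `N`-periodic
(`periodic_slash`), holomorphic and bounded there, so `f|_k A = O(e^{-2π y/N})`
(`IsZeroAtImInfty.exp_decay_atImInfty`).
[folklore] -/
theorem exists_petDensity_slash_le_exp (f : CuspForm (Gamma0 N) k) (A : SL(2, ℤ)) :
    ∃ C y₀ : ℝ, 0 ≤ C ∧ ∀ τ : ℍ, y₀ ≤ τ.im →
      petDensity k ((⇑f) ∣[k] A) τ ≤ C * Real.exp (-(2 * Real.pi / N) * τ.im) := by
  have hN : (0 : ℝ) < N := Nat.cast_pos.mpr (NeZero.pos N)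
  have hO := UpperHalfPlane.IsZeroAtImInfty.exp_decay_atImInfty (h := (N : ℝ))
    (CuspFormClass.zero_at_infty_slash f A) hN (periodic_slash f A)
    ((ModularFormClass.holo f).slash k A) (ModularFormClass.bdd_at_infty_slash f A)
  obtain ⟨C, hC0, hC⟩ := hO.exists_nonneg
  rw [Asymptotics.IsBigOWith, atImInfty, eventually_comap] at hC
  obtain ⟨y₁, hy₁⟩ := (Filter.eventually_atTop).mp hC
  obtain ⟨M, hM0, hM⟩ := exists_zpow_mul_exp_neg_le k (a := 2 * Real.pi / N) (by positivity)
  refine ⟨C ^ 2 * M, max y₁ 1, by positivity, fun τ hτ ↦ ?_⟩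
  have hy1 : y₁ ≤ τ.im := (le_max_left _ _).trans hτ
  have h1 : ‖((⇑f) ∣[k] A) τ‖ ≤ C * ‖Real.exp (-2 * Real.pi * τ.im / N)‖ := hy₁ τ.im hy1 τ rfl
  rw [Real.norm_of_nonneg (Real.exp_pos _).le] at h1
  have h2 : ‖((⇑f) ∣[k] A) τ‖ ^ 2 ≤ C ^ 2 * Real.exp (-2 * Real.pi * τ.im / N) ^ 2 := by
    rw [← mul_pow]; exact pow_le_pow_left₀ (norm_nonneg _) h1 2
  have h3 : τ.im ^ k * Real.exp (-(2 * Real.pi / N) * τ.im) ≤ M := hM τ.im ((le_max_right _ _).trans hτ)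
  have hexp : Real.exp (-2 * Real.pi * τ.im / N) ^ 2 =
      Real.exp (-(2 * Real.pi / N) * τ.im) * Real.exp (-(2 * Real.pi / N) * τ.im) := by
    rw [sq]; congr 1 <;> congr 1 <;> ring
  unfold petDensity
  calc ‖((⇑f) ∣[k] A) τ‖ ^ 2 * τ.im ^ k
      ≤ (C ^ 2 * Real.exp (-2 * Real.pi * τ.im / N) ^ 2) * τ.im ^ k :=
        mul_le_mul_of_nonneg_right h2 (zpow_nonneg τ.im_pos.le _)
    _ = C ^ 2 * (τ.im ^ k * Real.exp (-(2 * Real.pi / N) * τ.im)) *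
          Real.exp (-(2 * Real.pi / N) * τ.im) := by rw [hexp]; ring
    _ ≤ C ^ 2 * M * Real.exp (-(2 * Real.pi / N) * τ.im) := by
        gcongr

/-- **Exponential decay of `G_f` in the cusp**: for `f ∈ S_k(Γ₀(N))` there are `C ≥ 0` and
`c > 0` with `G_f(τ) ≤ C e^{-c Im τ}` whenever `Im τ ≥ 1` (each of the finitely many translates
decays, `exists_petDensity_slash_le_exp`, and is bounded below the threshold). [folklore] -/
theorem exists_rsTrace_le_exp (f : CuspForm (Gamma0 N) k) :
    ∃ C c : ℝ, 0 ≤ C ∧ 0 < c ∧ ∀ τ : ℍ, 1 ≤ τ.im → rsTrace N k f τ ≤ C * Real.exp (-c * τ.im) := by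
  classical
  haveI : Fintype (SL(2, ℤ) ⧸ Gamma0 N) := Fintype.ofFinite _
  have hN : (0 : ℝ) < N := Nat.cast_pos.mpr (NeZero.pos N)
  set c : ℝ := 2 * Real.pi / N with hc
  have hc0 : 0 < c := by positivity
  obtain ⟨B, hB0, hB⟩ := exists_rsTrace_le f
  -- per-coset constants
  have hq : ∀ q : SL(2, ℤ) ⧸ Gamma0 N, ∃ Cq : ℝ, 0 ≤ Cq ∧ ∀ τ : ℍ, 1 ≤ τ.im →
      petDensity k (⇑f) ((Quotient.out q)⁻¹ • τ) ≤ Cq * Real.exp (-c * τ.im) := by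
    intro q
    obtain ⟨C, y₀, hC0, hC⟩ := exists_petDensity_slash_le_exp f (Quotient.out q)⁻¹
    refine ⟨max C (B * Real.exp (c * max y₀ 1)), le_max_of_le_left hC0, fun τ hτ ↦ ?_⟩
    rw [← petDensity_slash]
    rcases le_or_gt y₀ τ.im with h | h
    · exact (hC τ h).trans (mul_le_mul_of_nonneg_right (le_max_left _ _) (Real.exp_pos _).le)
    · -- below the threshold: the global bound
      have h1 : petDensity k ((⇑f) ∣[k] (Quotient.out q)⁻¹) τ ≤ B := by
        rw [petDensity_slash]
        exact (petDensity_le_rsTrace (N := N) f _).trans (hB _)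
      have h2 : B ≤ B * Real.exp (c * max y₀ 1) * Real.exp (-c * τ.im) := by
        rw [mul_assoc, ← Real.exp_add]
        have : 0 ≤ c * max y₀ 1 + -c * τ.im := by
          have : τ.im ≤ max y₀ 1 := le_max_of_le_left h.le
          nlinarith
        calc B = B * 1 := (mul_one B).symm
          _ ≤ B * Real.exp (c * max y₀ 1 + -c * τ.im) :=
            mul_le_mul_of_nonneg_left (Real.one_le_exp this) hB0
      exact h1.trans (h2.trans (mul_le_mul_of_nonneg_right (le_max_right _ _) (Real.exp_pos _).le))
  choose Cq hCq0 hCq using hq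
  refine ⟨∑ q, Cq q, c, Finset.sum_nonneg fun q _ ↦ hCq0 q, hc0, fun τ hτ ↦ ?_⟩
  rw [rsTrace_eq_sum, Finset.sum_mul]
  exact Finset.sum_le_sum fun q _ ↦ hCq q τ hτ

end CuspForm

end Literature.NumberTheory.EllipticCurves.ModularForms

end
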